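import Mathlib
import Summits.Ventures.HodgeRepro.Tier4.Line1.HaarModulus
import Summits.Ventures.HodgeRepro.Tier4.Line1.ModulusVecMul

/-!
# Tier4/Line1/ModulusEmbed — the image of `GL_ι(F)` under «`M` at one place, the identity elsewhere» has the
determinant modulus (Mathlib only)

Blind re-derivation cell `pub-hodge-repro`, Tier 4 (README §9–§10), seat t4-L2-p2 (gen 2), wall-breaker on the
cocompactness rung C5 of LINE L1 («the adelic modulus», t4-L1-p5's `I1c-rungs-sig.lean`).  Target tree path
`lean/Summits/Ventures/HodgeRepro/Tier4/Line1/ModulusEmbed.lean`.  Imports `HaarModulus`, `ModulusVecMul`.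

THE PLACE STEP of the local-global modulus formula: for a non-unital ring homomorphism `s : F →ₙ+* R` from a FIELD
`F` into a locally compact second countable topological commutative ring `R` (on the adele ring: «`c` at the place
`v`, `0` elsewhere»), `embMat s M := 1 + (M - 1).map s` is «`M` at the place of `s`, the identity elsewhere»; it is
a monoid homomorphism `Matrix ι ι F →* Matrix ι ι R` carrying transvections to transvections and diagonal matrices
to diagonal matrices, so by Mathlib's decomposition `M = L · diagonal D · L′` over the field `F`
(`Matrix.Pivot.exists_list_transvec_mul_diagonal_mul_list_transvec`) the image of every invertible `M` has the
determinant modulus (`hasDetModulus_embMat`).  No topology on `F` is used.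

Nothing here asserts anything about the Hodge conjecture for CM abelian varieties, which is NOT proved (HC_CM is NOT
proved by anyone in this repository).
-/

set_option autoImplicit false

noncomputable section

namespace Summit.Ventures.HodgeRepro.Tier4.Line1

open MeasureTheory Measure Topology Matrix
open scoped ENNReal NNReal

section Embed

variable {ι : Type*} [Fintype ι] [DecidableEq ι]
variable {F : Type*} [Field F] {R : Type*} [CommRing R]

/-- **«`M` at the place of `s`, the identity elsewhere»**: `1 + (M - 1).map s`. -/
def embMat (s : F →ₙ+* R) (M : Matrix ι ι F) : Matrix ι ι R := 1 + (M - 1).map s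

omit [Fintype ι] in
/-- `embMat s 1 = 1`. -/
theorem embMat_one (s : F →ₙ+* R) : embMat s (1 : Matrix ι ι F) = 1 := by
  simp [embMat, Matrix.map_zero]

/-- `embMat s` is multiplicative (`s` is additive and multiplicative). -/
theorem embMat_mul (s : F →ₙ+* R) (M N : Matrix ι ι F) : embMat s (M * N) = embMat s M * embMat s N := by
  have hA : ∀ A B : Matrix ι ι F, (A + B).map s = A.map s + B.map s :=
    fun A B => Matrix.map_add s (map_add s) A B
  have key : M * N - 1 = (M - 1) + (N - 1) + (M - 1) * (N - 1) := by noncomm_ring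
  unfold embMat
  rw [key, hA, hA, Matrix.map_mul]
  noncomm_ring

/-- `embMat s` as a monoid homomorphism `Matrix ι ι F →* Matrix ι ι R`. -/
def embMatHom (s : F →ₙ+* R) : Matrix ι ι F →* Matrix ι ι R where
  toFun := embMat s
  map_one' := embMat_one s
  map_mul' := embMat_mul s

/-- `embMatHom s M = embMat s M`. -/
@[simp]
theorem embMatHom_apply (s : F →ₙ+* R) (M : Matrix ι ι F) : embMatHom s M = embMat s M := rfl

omit [Fintype ι] in
/-- `embMat s` carries a transvection to the transvection with entry `s c`. -/
theorem embMat_transvection (s : F →ₙ+* R) (i j : ι) (c : F) :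
    embMat s (transvection i j c) = transvection i j (s c) := by
  unfold embMat transvection
  rw [add_sub_cancel_left]
  congr 1
  ext i' j'
  simp only [Matrix.map_apply, single_apply]
  split_ifs <;> simp

omit [Fintype ι] in
/-- `embMat s` carries a diagonal matrix to the diagonal matrix with entries `1 + s (d l - 1)`. -/
theorem embMat_diagonal (s : F →ₙ+* R) (d : ι → F) :
    embMat s (diagonal d) = diagonal fun l => 1 + s (d l - 1) := by
  unfold embMat
  rw [show (1 : Matrix ι ι F) = diagonal fun _ => 1 from diagonal_one.symm, diagonal_sub,
    diagonal_map (map_zero s), show (1 : Matrix ι ι R) = diagonal fun _ => 1 from diagonal_one.symm, diagonal_add]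

/-- **«`a` at the place of `s`, `1` elsewhere»** as a unit of `R`: `1 + s (a - 1)`, with inverse `1 + s (a⁻¹ - 1)`. -/
def mulSingleUnit (s : F →ₙ+* R) (a : Fˣ) : Rˣ where
  val := 1 + s ((a : F) - 1)
  inv := 1 + s (((a⁻¹ : Fˣ) : F) - 1)
  val_inv := by
    have h : (1 + s ((a : F) - 1)) * (1 + s (((a⁻¹ : Fˣ) : F) - 1)) =
        1 + s (((a : F) - 1) + (((a⁻¹ : Fˣ) : F) - 1) + ((a : F) - 1) * (((a⁻¹ : Fˣ) : F) - 1)) := by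
      simp only [map_add, map_mul]
      ring
    have h2 : ((a : F) - 1) + (((a⁻¹ : Fˣ) : F) - 1) + ((a : F) - 1) * (((a⁻¹ : Fˣ) : F) - 1) = 0 := by
      have := Units.mul_inv a
      linear_combination this
    rw [h, h2, map_zero, add_zero]
  inv_val := by
    have h : (1 + s (((a⁻¹ : Fˣ) : F) - 1)) * (1 + s ((a : F) - 1)) =
        1 + s ((((a⁻¹ : Fˣ) : F) - 1) + ((a : F) - 1) + (((a⁻¹ : Fˣ) : F) - 1) * ((a : F) - 1)) := by
      simp only [map_add, map_mul]
      ring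
    have h2 : (((a⁻¹ : Fˣ) : F) - 1) + ((a : F) - 1) + (((a⁻¹ : Fˣ) : F) - 1) * ((a : F) - 1) = 0 := by
      have := Units.inv_mul a
      linear_combination this
    rw [h, h2, map_zero, add_zero]

/-- The value of `mulSingleUnit`. -/
@[simp]
theorem coe_mulSingleUnit (s : F →ₙ+* R) (a : Fˣ) : (mulSingleUnit s a : R) = 1 + s ((a : F) - 1) := rfl

/-- `Units.map (embMatHom s)` carries a transvection unit to a transvection unit. -/
theorem map_embMatHom_transvectionUnit (s : F →ₙ+* R) (i j : ι) (hij : i ≠ j) (c : F) :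
    Units.map (embMatHom s) (transvectionUnit i j hij c) = transvectionUnit i j hij (s c) := by
  ext
  simp [embMat_transvection]

/-- `Units.map (embMatHom s)` carries a unit diagonal matrix to a unit diagonal matrix. -/
theorem map_embMatHom_diagonalUnit (s : F →ₙ+* R) (u : ι → Fˣ) :
    Units.map (embMatHom s) (diagonalUnit u) = diagonalUnit fun l => mulSingleUnit s (u l) := by
  ext
  simp [embMat_diagonal]

/-- The units of a field matrix group built from a list of transvection structures. -/
def transvecUnits (L : List (TransvectionStruct ι F)) : List (Matrix ι ι F)ˣ :=
  L.map fun t => transvectionUnit t.i t.j t.hij t.c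

/-- The value of the product of `transvecUnits L` is the product of the transvection matrices. -/
theorem coe_transvecUnits_prod (L : List (TransvectionStruct ι F)) :
    (((transvecUnits L).prod : (Matrix ι ι F)ˣ) : Matrix ι ι F) = (L.map TransvectionStruct.toMatrix).prod := by
  rw [← Units.coeHom_apply, map_list_prod, transvecUnits, List.map_map]
  rfl

/-- Every invertible matrix over a field is a product `L · diagonal D · L′` of unit transvections and a unit
diagonal matrix, in the group of units. -/
theorem exists_transvecUnits_mul_diagonalUnit (M : (Matrix ι ι F)ˣ) :
    ∃ (L L' : List (TransvectionStruct ι F)) (u : ι → Fˣ),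
      M = (transvecUnits L).prod * diagonalUnit u * (transvecUnits L').prod := by
  obtain ⟨L, L', D, hM⟩ := Matrix.Pivot.exists_list_transvec_mul_diagonal_mul_list_transvec (M : Matrix ι ι F)
  have hdet : IsUnit (det (M : Matrix ι ι F)) := (Matrix.isUnit_iff_isUnit_det _).1 M.isUnit
  have hD : ∀ l, D l ≠ 0 := by
    have h1 : det (M : Matrix ι ι F) = ∏ l, D l := by
      rw [hM, det_mul, det_mul, TransvectionStruct.det_toMatrix_prod, TransvectionStruct.det_toMatrix_prod,
        det_diagonal, one_mul, mul_one]
    have h2 : ∏ l, D l ≠ 0 := h1 ▸ hdet.ne_zero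
    exact fun l => (Finset.prod_ne_zero_iff.1 h2) l (Finset.mem_univ l)
  refine ⟨L, L', fun l => Units.mk0 (D l) (hD l), Units.ext ?_⟩
  rw [Units.val_mul, Units.val_mul, coe_transvecUnits_prod, coe_transvecUnits_prod, coe_diagonalUnit]
  simpa [Units.val_mk0] using hM

end Embed

section Modulus

variable {ι : Type*} [Fintype ι] [DecidableEq ι]
variable {F : Type*} [Field F]
variable {R : Type*} [CommRing R] [TopologicalSpace R] [IsTopologicalRing R] [LocallyCompactSpace R]
  [SecondCountableTopology R] [MeasurableSpace R] [BorelSpace R]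
variable (μ : Measure (ι → R)) [μ.IsAddHaarMeasure] (ν : Measure R) [ν.IsAddHaarMeasure]

/-- **The place step**: the image under `embMatHom s` of every invertible matrix over the field `F` has the
determinant modulus. -/
theorem hasDetModulus_embMat (s : F →ₙ+* R) (M : (Matrix ι ι F)ˣ) :
    HasDetModulus μ ν (Units.map (embMatHom s) M) := by
  obtain ⟨L, L', u, hM⟩ := exists_transvecUnits_mul_diagonalUnit M
  have htr : ∀ L : List (TransvectionStruct ι F),
      HasDetModulus μ ν (Units.map (embMatHom s) (transvecUnits L).prod) := by
    intro L
    rw [map_list_prod]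
    refine hasDetModulus_list_prod μ ν _ fun N hN => ?_
    rw [transvecUnits, List.map_map, List.mem_map] at hN
    obtain ⟨t, -, rfl⟩ := hN
    simp only [Function.comp, map_embMatHom_transvectionUnit]
    exact hasDetModulus_transvectionUnit μ ν _ _ _ _
  rw [hM, map_mul, map_mul, map_embMatHom_diagonalUnit]
  exact ((htr L).mul μ ν (hasDetModulus_diagonalUnit μ ν _)).mul μ ν (htr L')

end Modulus

end Summit.Ventures.HodgeRepro.Tier4.Line1

end
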